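import Mathlib
import Summits.ValiantsHypothesis.ValiantsHypothesis.Theorems.NewtonUnitEquationsTwoProductsPlanarCellSingleRelationClasses
import HarnessLib

/-!
# Crux `TwoProducts` (stmt-ValiantsHypothesis-5906): the SINGLE-RELATION LAW — rung R1 of the line `relation_ladder`
# (one primitive relation class of ANY support length ⇒ per cell `#S ≤ 10·(m+1)³·(s+2)³`)

Helper mode (`--supports stmt-ValiantsHypothesis-5906 --as helper`; val-lit-p3 g14, KEEP lineage).  `singleRelationLaw` below is
the statement `SingleRelationLaw` of `Cruxes/TwoProducts/Lines/relation_ladder.lean` (val-idea-8 g2; v8 l.1185) with the line's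
`SingleRelation` unfolded over the ported `PlanarCell.tuples` / `PlanarCell.IsCellFamily` (p607798), constants `(c, d) = (10, 3)`;
the line's `stub_singleRelation` closes by `exact PlanarCell.singleRelationLaw` (definitional unfolding of `RelationLadder.tuples`,
`RelationLadder.IsCellFamily`).  NOT covered by the proved block law R2⁺ (`|J| = m` gives a block sumset of size `(s+1)^m`).

PROOF (val-neg-1 g1's route, `NOTE-neg1-5906-negative-followups.md` §1, on the p603804 / p604128 template).  Choose for every
visible point `l` of the cell a representation `rep l ∈ ∏(A_j ∪ {0})` with `F(rep l) ≠ G(rep l)` (fibre sums).  Split by the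
`J`-part `c = rep l|J` against the relation `(a₀|J, b₀|J)`:
* MERGED (`c = a₀|J` or `c = b₀|J`): `≤ 2(m+1)` each (`card_merged_le`: constants absorb the partner);
* FAR (`c` at Hamming distance `≥ 3` from both): every `≤ 2`-position upgrade stays at distance `≥ 1`, hence is uniquely
  represented (`eq_of_lone`) ⇒ all far points form ONE lone family ⇒ `≤ 2(m+1)` (`card_lone_group_le`);
* NEAR (lone, distance `≤ 2` from `a₀|J` or `b₀|J`): group by the `J`-part; inside a group upgrades keep the `J`-part ⇒
  `≤ 2(m+1)` per group, and the groups are indexed by two letter modifications of `a₀|J` or `b₀|J`: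
  `≤ 2·(m(s+1))²` groups (`key_mem_nbhd`).
Total `≤ 6(m+1) + 4(m+1)(m(s+1))² ≤ 10(m+1)³(s+2)³`.

Honest framing: a WITNESS RUNG outside the cone of an OPEN crux line (the line's residual `stub_residual`, `PlanarCellBound`,
the crux `TwoProducts` and `VP ≠ VNP` are OPEN and NOT claimed); no summit statement is proved here.  No instances, no notation,
no named facts. [folklore]
-/

noncomputable section

-- Sub = Summit single-conjunct layout: the duplicated namespace component is mandated by the tree.
set_option linter.dupNamespace false

open scoped BigOperators
open MvPolynomial
open Summit.ValiantsHypothesis.ValiantsHypothesis.Theorems.NewtonUnitEquations.TwoProducts.FormalLogLinearisation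

namespace Summit.ValiantsHypothesis.ValiantsHypothesis.Theorems.NewtonUnitEquations.TwoProducts.PlanarCell

variable {m : ℕ}

/-! ## Far tuples stay lone under two-letter upgrades -/

/-- If `c|J` differs from `x|J` in at least three positions and `a'` agrees with `c` outside `{j, j'}`, then `a'|J ≠ x|J`.
[folklore] -/
theorem not_Jpart_of_far (J : Finset (Fin m)) (x c a' : Fin m → Expo) (j j' : Fin m)
    (h3 : 3 ≤ (J.filter fun i => c i ≠ x i).card) (hagree : ∀ i, i ≠ j → i ≠ j' → a' i = c i) :
    ¬ ∀ i ∈ J, a' i = x i := by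
  classical
  intro hall
  have hsub : (J.filter fun i => c i ≠ x i) ⊆ {j, j'} := by
    intro i hi
    rw [Finset.mem_filter] at hi
    rw [Finset.mem_insert, Finset.mem_singleton]
    by_contra hnot
    push Not at hnot
    exact hi.2 (by rw [← hagree i hnot.1 hnot.2]; exact hall i hi.1)
  have := (Finset.card_le_card hsub).trans Finset.card_le_two
  omega

/-! ## Near `J`-parts are two letter modifications of `a₀|J` (or `b₀|J`) -/

/-- The `J`-part of a tuple `c ∈ ∏(A_i ∪ {0})` differing from `x|J` in one or two positions is obtained from `x|J` by two
letter modifications `(i, e)`, `i ∈ J`, `e ∈ A_i ∪ {0}`. [folklore] -/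
theorem key_mem_nbhd (A : Fin m → Finset Expo) (J : Finset (Fin m)) (x c : Fin m → Expo) (hc : c ∈ tuples A)
    (h1 : 1 ≤ (J.filter fun i => c i ≠ x i).card) (h2 : (J.filter fun i => c i ≠ x i).card ≤ 2) :
    (fun i => if i ∈ J then c i else (0 : Expo)) ∈
      ((J.biUnion fun i => (insert (0 : Expo) (A i)).image (Prod.mk i)) ×ˢ
        (J.biUnion fun i => (insert (0 : Expo) (A i)).image (Prod.mk i))).image
        (fun p : (Fin m × Expo) × (Fin m × Expo) =>
          Function.update (Function.update (fun i => if i ∈ J then x i else (0 : Expo)) p.1.1 p.1.2) p.2.1 p.2.2) := by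
  classical
  set D := J.filter fun i => c i ≠ x i with hD
  set Mod := J.biUnion fun i => (insert (0 : Expo) (A i)).image (Prod.mk i) with hMod
  have hmod : ∀ i ∈ J, (i, c i) ∈ Mod := fun i hi =>
    Finset.mem_biUnion.2 ⟨i, hi, Finset.mem_image.2 ⟨c i, Fintype.mem_piFinset.1 hc i, rfl⟩⟩
  have hDJ : ∀ i ∈ D, i ∈ J := fun i hi => (Finset.mem_filter.1 hi).1
  have hoff : ∀ i ∈ J, i ∉ D → c i = x i := by
    intro i hi hiD
    by_contra hne
    exact hiD (Finset.mem_filter.2 ⟨hi, hne⟩)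
  have hcard : D.card = 1 ∨ D.card = 2 := by omega
  rcases hcard with h | h
  · obtain ⟨i₀, hD1⟩ := Finset.card_eq_one.1 h
    have hi₀D : i₀ ∈ D := by rw [hD1]; exact Finset.mem_singleton_self _
    have hi₀J : i₀ ∈ J := hDJ i₀ hi₀D
    refine Finset.mem_image.2 ⟨((i₀, c i₀), (i₀, c i₀)), Finset.mem_product.2 ⟨hmod i₀ hi₀J, hmod i₀ hi₀J⟩, ?_⟩
    funext i
    by_cases hi : i = i₀
    · subst hi
      simp only [Function.update_self, if_pos hi₀J]
    · simp only [Function.update_of_ne hi]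
      by_cases hiJ : i ∈ J
      · rw [if_pos hiJ, if_pos hiJ]
        have hiD : i ∉ D := by rw [hD1, Finset.mem_singleton]; exact hi
        exact (hoff i hiJ hiD).symm
      · rw [if_neg hiJ, if_neg hiJ]
  · obtain ⟨i₀, i₁, hne, hD2⟩ := Finset.card_eq_two.1 h
    have hi₀D : i₀ ∈ D := by rw [hD2]; exact Finset.mem_insert_self _ _
    have hi₁D : i₁ ∈ D := by rw [hD2, Finset.mem_insert, Finset.mem_singleton]; exact Or.inr rfl
    have hi₀J : i₀ ∈ J := hDJ i₀ hi₀D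
    have hi₁J : i₁ ∈ J := hDJ i₁ hi₁D
    refine Finset.mem_image.2 ⟨((i₀, c i₀), (i₁, c i₁)), Finset.mem_product.2 ⟨hmod i₀ hi₀J, hmod i₁ hi₁J⟩, ?_⟩
    funext i
    by_cases hi : i = i₁
    · subst hi
      simp only [Function.update_self, if_pos hi₁J]
    · simp only [Function.update_of_ne hi]
      by_cases hi' : i = i₀
      · subst hi'
        simp only [Function.update_self, if_pos hi₀J]
      · simp only [Function.update_of_ne hi']
        by_cases hiJ : i ∈ J
        · rw [if_pos hiJ, if_pos hiJ]
          have hiD : i ∉ D := by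
            rw [hD2, Finset.mem_insert, Finset.mem_singleton]; push Not; exact ⟨hi', hi⟩
          exact (hoff i hiJ hiD).symm
        · rw [if_neg hiJ, if_neg hiJ]

/-- The set of two-modification `J`-parts has at most `(m(s+1))²` elements per base point. [folklore] -/
theorem card_JpartNbhd_le (A : Fin m → Finset Expo) (s : ℕ) (hA0 : ∀ j, (0 : Expo) ∉ A j) (hAs : ∀ j, (A j).card ≤ s)
    (J : Finset (Fin m)) (x : Fin m → Expo) :
    (((J.biUnion fun i => (insert (0 : Expo) (A i)).image (Prod.mk i)) ×ˢ
        (J.biUnion fun i => (insert (0 : Expo) (A i)).image (Prod.mk i))).image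
        (fun p : (Fin m × Expo) × (Fin m × Expo) =>
          Function.update (Function.update (fun i => if i ∈ J then x i else (0 : Expo)) p.1.1 p.1.2) p.2.1 p.2.2)).card ≤
      (m * (s + 1)) ^ 2 := by
  classical
  set Mod := J.biUnion fun i => (insert (0 : Expo) (A i)).image (Prod.mk i) with hMod
  have hModcard : Mod.card ≤ m * (s + 1) := by
    calc Mod.card ≤ ∑ i ∈ J, ((insert (0 : Expo) (A i)).image (Prod.mk i)).card := Finset.card_biUnion_le
      _ ≤ ∑ _i ∈ J, (s + 1) := Finset.sum_le_sum fun i _ => Finset.card_image_le.trans (by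
          rw [Finset.card_insert_of_notMem (hA0 i)]; exact Nat.succ_le_succ (hAs i))
      _ = J.card * (s + 1) := by rw [Finset.sum_const, smul_eq_mul]
      _ ≤ m * (s + 1) := Nat.mul_le_mul_right _ (by simpa using Finset.card_le_univ J)
  calc _ ≤ (Mod ×ˢ Mod).card := Finset.card_image_le
    _ = Mod.card * Mod.card := Finset.card_product _ _
    _ ≤ (m * (s + 1)) * (m * (s + 1)) := Nat.mul_le_mul hModcard hModcard
    _ = (m * (s + 1)) ^ 2 := by ring

/-! ## The single-relation cell bound -/

/-- **SINGLE RELATION ⇒ PER-CELL BOUND (explicit form).**  Tails in `A_j ∌ 0` with `#A_j ≤ s`, one primitive relation class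
`(J, a₀, b₀)`; then every cell family has `#S ≤ 6(m+1) + 4(m+1)·(m(s+1))²`. [folklore] -/
theorem planarCell_singleRelation (u v : Fin m → MvPolynomial (Fin 2) ℂ) (A : Fin m → Finset Expo) (s : ℕ)
    (hA0 : ∀ j, (0 : Expo) ∉ A j) (hAs : ∀ j, (A j).card ≤ s)
    (huA : ∀ j, (u j).support ⊆ A j) (hvA : ∀ j, (v j).support ⊆ A j)
    (J : Finset (Fin m)) (a₀ b₀ : Fin m → Expo)
    (hSR : ∀ a ∈ tuples A, ∀ b ∈ tuples A, a ≠ b → ∑ j, a j = ∑ j, b j →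
      (∀ j, a j ≠ b j ↔ j ∈ J) ∧ ((∀ j ∈ J, a j = a₀ j ∧ b j = b₀ j) ∨ (∀ j ∈ J, a j = b₀ j ∧ b j = a₀ j)))
    (R : Expo → Expo → Prop) (S : Finset Expo) (hS : IsCellFamily u v R S) :
    S.card ≤ 6 * (m + 1) + 4 * (m + 1) * (m * (s + 1)) ^ 2 := by
  classical
  set PF := tuples A with hPF
  set T := tailSupport u v with hT
  have hu0 : ∀ j, coeff 0 (u j) = 0 := fun j => notMem_support_iff.1 fun h => hA0 j (huA j h)
  have hv0 : ∀ j, coeff 0 (v j) = 0 := fun j => notMem_support_iff.1 fun h => hA0 j (hvA j h)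
  rcases S.eq_empty_or_nonempty with hS0 | ⟨l₀, hl₀⟩
  · simp [hS0]
  obtain ⟨ζ, hζval, -, hRζ⟩ := hS l₀ hl₀
  -- representations with `F ≠ G`
  have hrep : ∀ l ∈ S, ∃ a ∈ PF, ∑ j, a j = l ∧
      ∏ j, hatCoeff (u j) (a j) ≠ ∏ j, hatCoeff (v j) (a j) := by
    intro l hl
    obtain ⟨ξ, hval, htop, -⟩ := hS l hl
    have hmem : l ∈ (tailDiff u v).support := ((stub_logLinearisation m u v hu0 hv0 ξ hval l).2 htop).1
    have hne : coeff l (tailDiff u v) ≠ 0 := mem_support_iff.1 hmem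
    have hW : tailDiff u v = ∏ j, (1 + u j) - ∏ j, (1 + v j) := rfl
    rw [hW, coeff_sub, coeff_prod_one_add_eq_fibreSum u A hA0 huA, coeff_prod_one_add_eq_fibreSum v A hA0 hvA,
      ← Finset.sum_sub_distrib] at hne
    obtain ⟨a, ha, hne'⟩ := Finset.exists_ne_zero_of_sum_ne_zero hne
    rw [Finset.mem_filter] at ha
    exact ⟨a, ha.1, ha.2, fun h => hne' (sub_eq_zero.2 h)⟩
  choose! rep hrepPF hrepsum hrepne using hrep
  -- letters of representations are `0` or tail exponents
  have hT_of : ∀ (w : Fin m → MvPolynomial (Fin 2) ℂ) (i : Fin m) (e : Expo), (w = u ∨ w = v) →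
      hatCoeff (w i) e ≠ 0 → e = 0 ∨ e ∈ T := by
    intro w i e hw hne
    by_cases he : e = 0
    · exact Or.inl he
    · right
      simp only [hatCoeff, he, if_false] at hne
      have hmem : e ∈ (w i).support := mem_support_iff.2 hne
      rcases hw with rfl | rfl
      · exact Finset.mem_union_left _ (Finset.mem_biUnion.2 ⟨i, Finset.mem_univ _, hmem⟩)
      · exact Finset.mem_union_right _ (Finset.mem_biUnion.2 ⟨i, Finset.mem_univ _, hmem⟩)
  have hrepT : ∀ l ∈ S, ∀ i, rep l i = 0 ∨ rep l i ∈ T := by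
    intro l hl i
    by_cases hF : ∏ j, hatCoeff (u j) (rep l j) = 0
    · have hG : ∏ j, hatCoeff (v j) (rep l j) ≠ 0 := fun hG => hrepne l hl (by rw [hF, hG])
      exact hT_of v i _ (Or.inr rfl) (Finset.prod_ne_zero_iff.1 hG i (Finset.mem_univ _))
    · exact hT_of u i _ (Or.inl rfl) (Finset.prod_ne_zero_iff.1 hF i (Finset.mem_univ _))
  -- shapes of upgrades
  have hshape : ∀ (l l₁ l₂ : Expo) (j j' : Fin m) (a' : Fin m → Expo),
      (a' = Function.update (rep l) j (rep l₁ j) ∨ a' = Function.update (rep l) j' (rep l₂ j') ∨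
          a' = Function.update (Function.update (rep l) j (rep l₁ j)) j' (rep l₂ j')) →
      (∀ i, a' i = rep l i ∨ a' i = rep l₁ i ∨ a' i = rep l₂ i) ∧ (∀ i, i ≠ j → i ≠ j' → a' i = rep l i) := by
    intro l l₁ l₂ j j' a' ha'
    rcases ha' with rfl | rfl | rfl
    · refine ⟨fun i => ?_, fun i hij _ => by rw [Function.update_of_ne hij]⟩
      by_cases hi : i = j
      · subst hi; rw [Function.update_self]; exact Or.inr (Or.inl rfl)
      · rw [Function.update_of_ne hi]; exact Or.inl rfl
    · refine ⟨fun i => ?_, fun i _ hij' => by rw [Function.update_of_ne hij']⟩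
      by_cases hi : i = j'
      · subst hi; rw [Function.update_self]; exact Or.inr (Or.inr rfl)
      · rw [Function.update_of_ne hi]; exact Or.inl rfl
    · refine ⟨fun i => ?_, fun i hij hij' => by rw [Function.update_of_ne hij', Function.update_of_ne hij]⟩
      by_cases hi : i = j'
      · subst hi; rw [Function.update_self]; exact Or.inr (Or.inr rfl)
      · rw [Function.update_of_ne hi]
        by_cases hi2 : i = j
        · subst hi2; rw [Function.update_self]; exact Or.inr (Or.inl rfl)
        · rw [Function.update_of_ne hi2]; exact Or.inl rfl
  have hshapePF : ∀ l ∈ S, ∀ l₁ ∈ S, ∀ l₂ ∈ S, ∀ (j j' : Fin m) (a' : Fin m → Expo),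
      (a' = Function.update (rep l) j (rep l₁ j) ∨ a' = Function.update (rep l) j' (rep l₂ j') ∨
          a' = Function.update (Function.update (rep l) j (rep l₁ j)) j' (rep l₂ j')) → a' ∈ PF := by
    intro l hl l₁ hl₁ l₂ hl₂ j j' a' ha'
    have m0 := Fintype.mem_piFinset.1 (hrepPF l hl)
    have m1 := Fintype.mem_piFinset.1 (hrepPF l₁ hl₁)
    have m2 := Fintype.mem_piFinset.1 (hrepPF l₂ hl₂)
    refine Fintype.mem_piFinset.2 fun i => ?_
    rcases (hshape l l₁ l₂ j j' a' ha').1 i with h | h | h <;> rw [h]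
    · exact m0 i
    · exact m1 i
    · exact m2 i
  -- the four families
  set Sa := S.filter fun l => ∀ i ∈ J, rep l i = a₀ i with hSa
  set Sb := S.filter fun l => ∀ i ∈ J, rep l i = b₀ i with hSb
  set Sfar := S.filter fun l => 3 ≤ (J.filter fun i => rep l i ≠ a₀ i).card ∧
    3 ≤ (J.filter fun i => rep l i ≠ b₀ i).card with hSfar
  set Snear := S.filter fun l => ¬ (∀ i ∈ J, rep l i = a₀ i) ∧ ¬ (∀ i ∈ J, rep l i = b₀ i) ∧
    ¬ (3 ≤ (J.filter fun i => rep l i ≠ a₀ i).card ∧ 3 ≤ (J.filter fun i => rep l i ≠ b₀ i).card) with hSnear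
  have hcover : S ⊆ Sa ∪ Sb ∪ Sfar ∪ Snear := by
    intro l hl
    simp only [Finset.mem_union]
    by_cases ha : ∀ i ∈ J, rep l i = a₀ i
    · exact Or.inl (Or.inl (Or.inl (Finset.mem_filter.2 ⟨hl, ha⟩)))
    by_cases hb : ∀ i ∈ J, rep l i = b₀ i
    · exact Or.inl (Or.inl (Or.inr (Finset.mem_filter.2 ⟨hl, hb⟩)))
    by_cases hf : 3 ≤ (J.filter fun i => rep l i ≠ a₀ i).card ∧ 3 ≤ (J.filter fun i => rep l i ≠ b₀ i).card
    · exact Or.inl (Or.inr (Finset.mem_filter.2 ⟨hl, hf⟩))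
    · exact Or.inr (Finset.mem_filter.2 ⟨hl, ha, hb, hf⟩)
  -- merged families
  have hSacard : Sa.card ≤ 2 * (m + 1) :=
    card_merged_le u v A hA0 huA hvA J a₀ b₀ hSR R S hS ζ hζval hRζ rep hrepPF hrepsum hrepT
  have hSR' : ∀ a ∈ tuples A, ∀ b ∈ tuples A, a ≠ b → ∑ j, a j = ∑ j, b j →
      (∀ j, a j ≠ b j ↔ j ∈ J) ∧ ((∀ j ∈ J, a j = b₀ j ∧ b j = a₀ j) ∨ (∀ j ∈ J, a j = a₀ j ∧ b j = b₀ j)) :=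
    fun a ha b hb hne hsum => ⟨(hSR a ha b hb hne hsum).1, (hSR a ha b hb hne hsum).2.symm⟩
  have hSbcard : Sb.card ≤ 2 * (m + 1) :=
    card_merged_le u v A hA0 huA hvA J b₀ a₀ hSR' R S hS ζ hζval hRζ rep hrepPF hrepsum hrepT
  -- the far family is lone and closed under upgrades
  have hSfarcard : Sfar.card ≤ 2 * (m + 1) := by
    refine card_lone_group_le u v A hA0 huA hvA R S hS ζ hζval hRζ rep hrepPF hrepsum Sfar
      (fun l hl => (Finset.mem_filter.1 hl).1) (fun l hl => hrepne l (Finset.mem_filter.1 hl).1) ?_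
    intro l hl l₁ hl₁ l₂ hl₂ j j' a' ha' b hb hsum
    have hlS := (Finset.mem_filter.1 hl).1
    have hfar := (Finset.mem_filter.1 hl).2
    have hagree := (hshape l l₁ l₂ j j' a' ha').2
    exact eq_of_lone A J a₀ b₀ hSR
      (hshapePF l hlS l₁ (Finset.mem_filter.1 hl₁).1 l₂ (Finset.mem_filter.1 hl₂).1 j j' a' ha')
      (not_Jpart_of_far J a₀ (rep l) a' j j' hfar.1 hagree) (not_Jpart_of_far J b₀ (rep l) a' j j' hfar.2 hagree) hb hsum
  -- the near family, grouped by the `J`-part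
  let key : Expo → (Fin m → Expo) := fun l i => if i ∈ J then rep l i else 0
  have hkeyJ : ∀ l l' : Expo, key l' = key l → ∀ i ∈ J, rep l' i = rep l i := by
    intro l l' h i hi
    have := congrFun h i
    simp only [key, if_pos hi] at this
    exact this
  have hgroup : ∀ c : Fin m → Expo, (Snear.filter fun l => key l = c).card ≤ 2 * (m + 1) := by
    intro c
    refine card_lone_group_le u v A hA0 huA hvA R S hS ζ hζval hRζ rep hrepPF hrepsum (Snear.filter fun l => key l = c)
      (fun l hl => (Finset.mem_filter.1 (Finset.mem_filter.1 hl).1).1)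
      (fun l hl => hrepne l (Finset.mem_filter.1 (Finset.mem_filter.1 hl).1).1) ?_
    intro l hl l₁ hl₁ l₂ hl₂ j j' a' ha' b hb hsum
    have hl' := Finset.mem_filter.1 hl
    have hl₁' := Finset.mem_filter.1 hl₁
    have hl₂' := Finset.mem_filter.1 hl₂
    have hlS := (Finset.mem_filter.1 hl'.1).1
    have hnear := (Finset.mem_filter.1 hl'.1).2
    have hk₁ : key l₁ = key l := hl₁'.2.trans hl'.2.symm
    have hk₂ : key l₂ = key l := hl₂'.2.trans hl'.2.symm
    -- the upgrade keeps the `J`-part of `rep l`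
    have hJ' : ∀ i ∈ J, a' i = rep l i := by
      intro i hi
      rcases (hshape l l₁ l₂ j j' a' ha').1 i with h | h | h
      · exact h
      · rw [h]; exact hkeyJ l l₁ hk₁ i hi
      · rw [h]; exact hkeyJ l l₂ hk₂ i hi
    refine eq_of_lone A J a₀ b₀ hSR
      (hshapePF l hlS l₁ (Finset.mem_filter.1 hl₁'.1).1 l₂ (Finset.mem_filter.1 hl₂'.1).1 j j' a' ha') ?_ ?_ hb hsum
    · intro hall; exact hnear.1 fun i hi => (hJ' i hi).symm.trans (hall i hi)
    · intro hall; exact hnear.2.1 fun i hi => (hJ' i hi).symm.trans (hall i hi)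
  -- the keys of near points
  set Mod := J.biUnion fun i => (insert (0 : Expo) (A i)).image (Prod.mk i) with hMod
  set NbA := (Mod ×ˢ Mod).image (fun p : (Fin m × Expo) × (Fin m × Expo) =>
    Function.update (Function.update (fun i => if i ∈ J then a₀ i else (0 : Expo)) p.1.1 p.1.2) p.2.1 p.2.2) with hNbA
  set NbB := (Mod ×ˢ Mod).image (fun p : (Fin m × Expo) × (Fin m × Expo) =>
    Function.update (Function.update (fun i => if i ∈ J then b₀ i else (0 : Expo)) p.1.1 p.1.2) p.2.1 p.2.2) with hNbB
  have himage : Snear.image key ⊆ NbA ∪ NbB := by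
    intro c hc
    obtain ⟨l, hl, rfl⟩ := Finset.mem_image.1 hc
    have hlS := (Finset.mem_filter.1 hl).1
    obtain ⟨hna, hnb, hnf⟩ := (Finset.mem_filter.1 hl).2
    have h1a : 1 ≤ (J.filter fun i => rep l i ≠ a₀ i).card := by
      rw [Nat.one_le_iff_ne_zero]
      intro h0
      apply hna
      intro i hi
      by_contra hne
      have : i ∈ J.filter fun i => rep l i ≠ a₀ i := Finset.mem_filter.2 ⟨hi, hne⟩
      rw [Finset.card_eq_zero.1 h0] at this
      exact absurd this (Finset.notMem_empty _)
    have h1b : 1 ≤ (J.filter fun i => rep l i ≠ b₀ i).card := by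
      rw [Nat.one_le_iff_ne_zero]
      intro h0
      apply hnb
      intro i hi
      by_contra hne
      have : i ∈ J.filter fun i => rep l i ≠ b₀ i := Finset.mem_filter.2 ⟨hi, hne⟩
      rw [Finset.card_eq_zero.1 h0] at this
      exact absurd this (Finset.notMem_empty _)
    rw [Finset.mem_union]
    by_cases h2a : (J.filter fun i => rep l i ≠ a₀ i).card ≤ 2
    · exact Or.inl (key_mem_nbhd A J a₀ (rep l) (hrepPF l hlS) h1a h2a)
    · have h2b : (J.filter fun i => rep l i ≠ b₀ i).card ≤ 2 := by
        by_contra h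
        exact hnf ⟨by omega, by omega⟩
      exact Or.inr (key_mem_nbhd A J b₀ (rep l) (hrepPF l hlS) h1b h2b)
  have hNbcard : (NbA ∪ NbB).card ≤ 2 * (m * (s + 1)) ^ 2 := by
    calc (NbA ∪ NbB).card ≤ NbA.card + NbB.card := Finset.card_union_le _ _
      _ ≤ (m * (s + 1)) ^ 2 + (m * (s + 1)) ^ 2 :=
          Nat.add_le_add (card_JpartNbhd_le A s hA0 hAs J a₀) (card_JpartNbhd_le A s hA0 hAs J b₀)
      _ = 2 * (m * (s + 1)) ^ 2 := by ring
  have hSnearcard : Snear.card ≤ 2 * (m * (s + 1)) ^ 2 * (2 * (m + 1)) := by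
    calc Snear.card = ∑ c ∈ Snear.image key, (Snear.filter fun l => key l = c).card :=
          Finset.card_eq_sum_card_image key Snear
      _ ≤ ∑ _c ∈ Snear.image key, 2 * (m + 1) := Finset.sum_le_sum fun c _ => hgroup c
      _ = (Snear.image key).card * (2 * (m + 1)) := by rw [Finset.sum_const, smul_eq_mul]
      _ ≤ (NbA ∪ NbB).card * (2 * (m + 1)) := Nat.mul_le_mul_right _ (Finset.card_le_card himage)
      _ ≤ 2 * (m * (s + 1)) ^ 2 * (2 * (m + 1)) := Nat.mul_le_mul_right _ hNbcard
  -- total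
  calc S.card ≤ (Sa ∪ Sb ∪ Sfar ∪ Snear).card := Finset.card_le_card hcover
    _ ≤ Sa.card + Sb.card + Sfar.card + Snear.card := by
        refine (Finset.card_union_le _ _).trans (Nat.add_le_add_right ?_ _)
        refine (Finset.card_union_le _ _).trans (Nat.add_le_add_right ?_ _)
        exact Finset.card_union_le _ _
    _ ≤ 2 * (m + 1) + 2 * (m + 1) + 2 * (m + 1) + 2 * (m * (s + 1)) ^ 2 * (2 * (m + 1)) :=
        Nat.add_le_add (Nat.add_le_add (Nat.add_le_add hSacard hSbcard) hSfarcard) hSnearcard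
    _ = 6 * (m + 1) + 4 * (m + 1) * (m * (s + 1)) ^ 2 := by ring

/-! ## Rung R1 of `relation_ladder`, by name -/

/-- Closing arithmetic: `6(m+1) + 4(m+1)(m(s+1))² ≤ 10(m+1)³(s+2)³`. [folklore] -/
theorem singleRelation_arith (m s : ℕ) :
    6 * (m + 1) + 4 * (m + 1) * (m * (s + 1)) ^ 2 ≤ 10 * (m + 1) ^ 3 * (s + 2) ^ 3 := by
  have h1 : m * (s + 1) ≤ (m + 1) * (s + 2) := Nat.mul_le_mul (Nat.le_succ m) (Nat.le_succ (s + 1))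
  have h2 : (m * (s + 1)) ^ 2 ≤ ((m + 1) * (s + 2)) ^ 2 := Nat.pow_le_pow_left h1 2
  have h3 : 1 ≤ (m + 1) ^ 2 * (s + 2) ^ 3 := Nat.one_le_iff_ne_zero.2 (by positivity)
  have h4 : (s + 2) ^ 2 ≤ (s + 2) ^ 3 := Nat.pow_le_pow_right (by omega) (by omega)
  calc 6 * (m + 1) + 4 * (m + 1) * (m * (s + 1)) ^ 2
      ≤ 6 * (m + 1) * ((m + 1) ^ 2 * (s + 2) ^ 3) + 4 * (m + 1) * ((m + 1) * (s + 2)) ^ 2 := by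
        have := Nat.mul_le_mul_left (6 * (m + 1)) h3
        have := Nat.mul_le_mul_left (4 * (m + 1)) h2
        nlinarith
    _ = 6 * ((m + 1) ^ 3 * (s + 2) ^ 3) + 4 * ((m + 1) ^ 3 * (s + 2) ^ 2) := by ring
    _ ≤ 6 * ((m + 1) ^ 3 * (s + 2) ^ 3) + 4 * ((m + 1) ^ 3 * (s + 2) ^ 3) :=
        Nat.add_le_add_left (Nat.mul_le_mul_left 4 (Nat.mul_le_mul_left _ h4)) _
    _ = 10 * (m + 1) ^ 3 * (s + 2) ^ 3 := by ring

/-- **THE SINGLE-RELATION LAW (rung R1 of line `relation_ladder`, crux `TwoProducts`).**  Verbatim the line's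
`SingleRelationLaw` (with `SingleRelation A` unfolded): there are `c, d` (here `10, 3`) such that for all `m, s`, tails
`u_j, v_j` supported in `A_j ∌ 0` with `#A_j ≤ s`, if ONE primitive relation class `(J, a₀, b₀)` accounts for every additive
coincidence of letter tuples, then every weight-order cell family `S` of log-visible points has `#S ≤ c (m+1)^d (s+2)^d`.
The line's `stub_singleRelation` is `exact` this theorem. [folklore] -/
theorem singleRelationLaw :
    ∃ c d : ℕ, ∀ (m s : ℕ) (u v : Fin m → MvPolynomial (Fin 2) ℂ) (A : Fin m → Finset Expo),
      (∀ j, (0 : Expo) ∉ A j) → (∀ j, (A j).card ≤ s) → (∀ j, (u j).support ⊆ A j) → (∀ j, (v j).support ⊆ A j) →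
      (∃ J : Finset (Fin m), ∃ a₀ b₀ : Fin m → Expo, ∀ a ∈ tuples A, ∀ b ∈ tuples A, a ≠ b → ∑ j, a j = ∑ j, b j →
        (∀ j, a j ≠ b j ↔ j ∈ J) ∧ ((∀ j ∈ J, a j = a₀ j ∧ b j = b₀ j) ∨ (∀ j ∈ J, a j = b₀ j ∧ b j = a₀ j))) →
      ∀ (R : Expo → Expo → Prop) (S : Finset Expo), IsCellFamily u v R S →
        S.card ≤ c * (m + 1) ^ d * (s + 2) ^ d := by
  refine ⟨10, 3, ?_⟩
  intro m s u v A hA0 hAs huA hvA hrel R S hS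
  obtain ⟨J, a₀, b₀, hSR⟩ := hrel
  exact (planarCell_singleRelation u v A s hA0 hAs huA hvA J a₀ b₀ hSR R S hS).trans (singleRelation_arith m s)

end Summit.ValiantsHypothesis.ValiantsHypothesis.Theorems.NewtonUnitEquations.TwoProducts.PlanarCell

end
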